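import Mathlib
import Literature.AlgebraicGeometry.Resolution.BlowupPrincipalCharts
import Literature.AlgebraicGeometry.Resolution.BlowupLiftsCongruence
import Literature.AlgebraicGeometry.Resolution.BlowupStalkCharts
import Literature.AlgebraicGeometry.Resolution.AffineBlowup
import Literature.AlgebraicGeometry.Resolution.ProjectiveSpaceRegular
import Literature.AlgebraicGeometry.Resolution.ResolutionGlue

/-!
# A chart of a blowing up is a regular scheme when its chart ring is a regular ring

Crux stmt-ResolutionOfSingularities-15640 (`WildQuotients.WildQuotientResolution`), line `Sketch`;
chain w45c, programmes V3U/V4U (res-L1-w45c-stub-3): the `hQ`/`hOreg` input of the exit for the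
REGULAR chart of a NON-regular blow-up (`Bl_{(x_a,x_b²)}`: chart `D₊(x_b²t)`, D2 p485686;
`Bl_{I₆}`: chart `D₊(x_c⁶t)`, p489593), where the whole-scheme lemma
`JordanThree.isRegular_affineBlowup_of_charts` does not apply. [OURS · L1 W4.5c] — generic glue.

* `isRegular_opensRange_of_isRegularRing` — the range of an open immersion from `Spec` of a regular
  ring is a regular open subscheme.
* `isRegular_basicOpen_reesT_of_isRegularRing` — for `Bl_I(Spec R)`, `I = (c₀,…,c_{m−1})`: the
  generator chart `D₊(c_j t)` is regular as a scheme when `chartRing c j` is a regular ring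
  (`Proj.awayι`, `Proj.opensRange_awayι`).
* `isRegular_blowupChart_of_isRegularRing` — for ANY blow-up `π : X' → X` along `C` and `b ∈ C(U)`:
  the principal chart `X'[U, b]` is regular when the affine blowup algebra `Γ(X,U)[C(U)/b]` is
  (`IsBlowup.exists_ringEquiv_blowupChart`, `IsBlowup.isAffineOpen_blowupChart`).
Combine with `BlowupExit.isRegular_of_le` (p489276) for a stable affine `W ≤` chart.
-/

-- single-problem summit: the doubled namespace component `ResolutionOfSingularities` is forced
set_option linter.dupNamespace false

noncomputable section

universe u

open CategoryTheory AlgebraicGeometry TopologicalSpace HomogeneousLocalization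
open Literature.AlgebraicGeometry.Resolution

namespace Summit.ResolutionOfSingularities.ResolutionOfSingularities.Theorems.WildQuotientResolution.BlowupExit

/-- **The range of an open immersion from the spectrum of a regular ring is a regular open
subscheme.** [folklore] -/
theorem isRegular_opensRange_of_isRegularRing {A : CommRingCat.{u}} {Y : Scheme.{u}}
    (f : Spec A ⟶ Y) [IsOpenImmersion f] [IsRegularRing A] :
    Scheme.IsRegular (f.opensRange : Scheme.{u}) :=
  Scheme.IsRegular.of_iso f.isoOpensRange.hom (Scheme.isRegular_Spec A)

/-- **A generator chart `D₊(c_j t)` of `Bl_I(Spec R)` is regular when its chart ring is.**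
[cite: StacksProject, Tag 0804] -/
theorem isRegular_basicOpen_reesT_of_isRegularRing {R : Type u} [CommRing R] {m : ℕ}
    (c : Fin m → R) (j : Fin m) (hj : IsRegularRing (chartRing c j)) :
    Scheme.IsRegular (Proj.basicOpen (reesGrading (Ideal.span (Set.range c)))
      (reesT (c j) (Ideal.mem_span_range_self (f := c) (x := j))) : Scheme.{u}) := by
  haveI : IsRegularRing (CommRingCat.of (chartRing c j)) := hj
  let f := Proj.awayι (reesGrading (Ideal.span (Set.range c)))
    (reesT (c j) (Ideal.mem_span_range_self (f := c) (x := j)))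
    (reesT_mem (c j) (Ideal.mem_span_range_self (f := c) (x := j))) Nat.one_pos
  have hrange : f.opensRange = Proj.basicOpen (reesGrading (Ideal.span (Set.range c)))
      (reesT (c j) (Ideal.mem_span_range_self (f := c) (x := j))) :=
    Proj.opensRange_awayι _ _ _ _
  exact Scheme.IsRegular.of_iso ((affineBlowup (Ideal.span (Set.range c))).isoOfEq hrange).hom
    (isRegular_opensRange_of_isRegularRing f)

/-- **A principal chart `X'[U, b]` of a blowing up is regular when the affine blowup algebra
`Γ(X, U)[C(U)/b]` is a regular ring.** (`X'[U,b]` is affine with coordinate ring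
`≅ Γ(X,U)[C(U)/b]`.) [cite: StacksProject, Tag 0804] -/
theorem isRegular_blowupChart_of_isRegularRing {X' X : Scheme.{u}} {π : X' ⟶ X}
    {C : X.IdealSheafData} (hπ : IsBlowup π C) (U : X.affineOpens) {b : Γ(X, U)}
    (hb : b ∈ C.ideal U) (hreg : IsRegularRing (blowupAlgebra (C.ideal U) b)) :
    Scheme.IsRegular (blowupChart π C U b : Scheme.{u}) := by
  obtain ⟨e, -⟩ := hπ.exists_ringEquiv_blowupChart U hb
  haveI : IsRegularRing (blowupAlgebra (C.ideal U) b) := hreg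
  haveI : IsRegularRing Γ(X', blowupChart π C U b) := IsRegularRing.of_ringEquiv e.symm
  have hW : IsAffineOpen (blowupChart π C U b) := hπ.isAffineOpen_blowupChart hb
  exact Scheme.IsRegular.of_iso hW.isoSpec.inv (Scheme.isRegular_Spec _)

end Summit.ResolutionOfSingularities.ResolutionOfSingularities.Theorems.WildQuotientResolution.BlowupExit

end
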